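import Summits.CriticalPhenomena.PercolationContinuityZ3.Theorems.PercNearOneGluingNoHeavyLowerTailCILOwnEdgeStability
import HarnessLib

/-!
# `NoHeavyLowerTail` (stmt-CriticalPhenomena-4575) — hull-port line: a glued star stays behind its ports' dominator

Support file (prover `prim-hp-1`; `--supports stmt-CriticalPhenomena-4575`); no definitions, named facts or sorries.

`μ_w = prodBernoulli w` on `Fin n`, relays `A`, level `j`, `R_v = {|π(v)| ≤ j}`.  Let `x` be a vertex, `T` a nonempty
finite set of vertices with `w s(x,t) = 0` for `t ∈ T`, and `z ≠ x` a vertex dominating every `t ∈ T` in `w`-loneliness: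
`μ_w(R_t) ≤ μ_w(R_z)`.  GLUE `x` to `T` (set every `w s(x,t)`, `t ∈ T`, to `1`).  Then in the glued weights `x` (i.e. the block
`{x} ∪ T`) is still dominated by `z`:  `μ(R_x) ≤ μ(R_z)`  (`HullPort.dominates_gluedStar`).  Proof: own-edge stability
(`CutObserver.lightness_glued_le`, van den Berg–Häggström–Kahn Thm 1.5 via the tree) — the first edge `(x,t₁)` is glued AT `t₁`
(dominated by `z`), after which `x ↔ t₁` almost surely and `x` is dominated; every further edge `(x,t)` is glued AT `x`.
This is the scenario-level input "z ≥_K ports ⇒ z beats each glued block" of the pair-atom proof (crux memo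
HULLPORT-COUPLING.md §14). [cite: VandenbergHaggstromKahn2005, Thm. 1.5 (p. 7) — via own-edge stability]
-/

noncomputable section

namespace Summit.CriticalPhenomena.PercolationContinuityZ3.Theorems

open MeasureTheory Set Literature.Probability.LatticeModels Literature.Probability.Percolation
open scoped Classical BigOperators

variable {n : ℕ}

namespace HullPort

open CutObserver ChampionStability

/-- After gluing `s(x,t)` (from weight `0`), `x` and `t` have the same loneliness probability. [folklore] -/
theorem real_light_eq_of_glued (w : Sym2 (Fin n) → unitInterval) (A : Finset (Fin n)) (x t : Fin n) (j : ℕ)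
    (hxt : x ≠ t) (hw : w s(x, t) = 0) :
    (prodBernoulli (Function.update w s(x, t) 1)).real
        {ω : BondConfig (Fin n) | (A.filter fun y => ω ∈ openConn x y).card ≤ j} =
      (prodBernoulli (Function.update w s(x, t) 1)).real
        {ω : BondConfig (Fin n) | (A.filter fun y => ω ∈ openConn t y).card ≤ j} := by
  rw [real_update_one_eq w hw, real_update_one_eq w hw]
  congr 1
  ext ω
  simp only [mem_preimage, mem_setOf_eq]
  have hxt' : (openGraph (insert s(x, t) ω)).Reachable x t :=
    ((reachable_insert_to_left_iff ω hxt t).2 (Or.inr SimpleGraph.Reachable.rfl)).symm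
  have heq : (A.filter fun y => insert s(x, t) ω ∈ openConn x y) =
      (A.filter fun y => insert s(x, t) ω ∈ openConn t y) :=
    Finset.filter_congr fun y _ =>
      ⟨fun h => (hxt'.symm.trans h : (openGraph (insert s(x, t) ω)).Reachable t y),
        fun h => (hxt'.trans h : (openGraph (insert s(x, t) ω)).Reachable x y)⟩
  rw [heq]

/-- **A glued star stays behind its ports' dominator.**  Let `x ∉ T`, `z ≠ x`, `w s(x,t) = 0` and
`μ_w(R_t) ≤ μ_w(R_z)` for every `t ∈ T ≠ ∅`.  With `w_T = w[s(x,t) ↦ 1, t ∈ T]`:  `μ_{w_T}(R_x) ≤ μ_{w_T}(R_z)`.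
[cite: VandenbergHaggstromKahn2005, Thm. 1.5 (p. 7) — via own-edge stability `CutObserver.lightness_glued_le`] -/
theorem dominates_gluedStar (w : Sym2 (Fin n) → unitInterval) (A : Finset (Fin n)) (x z : Fin n) (j : ℕ)
    (hzx : z ≠ x) (T : Finset (Fin n)) (hxT : x ∉ T) (hT : T.Nonempty)
    (hw : ∀ t ∈ T, w s(x, t) = 0)
    (hdom : ∀ t ∈ T,
      (prodBernoulli w).real {ω : BondConfig (Fin n) | (A.filter fun y => ω ∈ openConn t y).card ≤ j} ≤
        (prodBernoulli w).real {ω : BondConfig (Fin n) | (A.filter fun y => ω ∈ openConn z y).card ≤ j}) :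
    (prodBernoulli (fun e => if ∃ t ∈ T, e = s(x, t) then 1 else w e)).real
        {ω : BondConfig (Fin n) | (A.filter fun y => ω ∈ openConn x y).card ≤ j} ≤
      (prodBernoulli (fun e => if ∃ t ∈ T, e = s(x, t) then 1 else w e)).real
        {ω : BondConfig (Fin n) | (A.filter fun y => ω ∈ openConn z y).card ≤ j} := by
  -- induction on `T`
  induction T using Finset.induction_on with
  | empty => exact absurd hT Finset.not_nonempty_empty
  | @insert t T htT ih =>
    set wT : Sym2 (Fin n) → unitInterval := fun e => if ∃ t' ∈ T, e = s(x, t') then 1 else w e with hwT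
    -- the glued weights for `insert t T` are `wT[s(x,t) ↦ 1]`
    have hupd : (fun e => if ∃ t' ∈ insert t T, e = s(x, t') then (1 : unitInterval) else w e) =
        Function.update wT s(x, t) 1 := by
      funext e
      by_cases he : e = s(x, t)
      · subst he
        rw [Function.update_self]
        simp only [Finset.mem_insert, exists_eq_or_imp, true_or, if_true]
      · rw [Function.update_of_ne he]
        simp only [hwT, Finset.mem_insert, exists_eq_or_imp, he, false_or]
    rw [hupd]
    have hxt : x ≠ t := fun h => hxT (h ▸ Finset.mem_insert_self t T)
    -- `wT` agrees with `w` on the pair `s(x,t)` (still weight 0)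
    have hwTt : wT s(x, t) = 0 := by
      have hne : ¬ ∃ t' ∈ T, s(x, t) = s(x, t') := by
        rintro ⟨t', ht', h⟩
        have : t = t' := by
          have h2 := Sym2.eq_iff.1 h
          rcases h2 with ⟨_, h⟩ | ⟨_, h⟩
          · exact h
          · exact absurd h.symm hxt
        exact htT (this ▸ ht')
      simp only [hwT, hne, if_false]
      exact hw t (Finset.mem_insert_self t T)
    by_cases hTe : T = ∅
    · -- first edge: glue AT `t`, which is dominated by `z` in `w = wT`
      have hwT_eq : wT = w := by
        funext e; simp only [hwT, hTe, Finset.notMem_empty, false_and, exists_false, if_false]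
      rw [hwT_eq]
      by_cases hzt : z = t
      · subst hzt
        rw [real_light_eq_of_glued w A x z j hxt (hw z (Finset.mem_insert_self z T))]
      · have key := lightness_glued_le w A t x z j hxt.symm hzt
          (by rw [Sym2.eq_swap]; exact hw t (Finset.mem_insert_self t T))
          (hdom t (Finset.mem_insert_self t T))
        rw [Sym2.eq_swap] at key
        rw [real_light_eq_of_glued w A x t j hxt (hw t (Finset.mem_insert_self t T))]
        exact key
    · -- later edges: glue AT `x`, dominated by `z` in `wT` by the induction hypothesis
      have hTne : T.Nonempty := Finset.nonempty_iff_ne_empty.2 hTe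
      have ih' := ih (fun h => hxT (Finset.mem_insert_of_mem h)) hTne
        (fun t' ht' => hw t' (Finset.mem_insert_of_mem ht'))
        (fun t' ht' => hdom t' (Finset.mem_insert_of_mem ht'))
      exact lightness_glued_le wT A x t z j hxt hzx hwTt ih'

/-! ### The localized transfer: outside both blocks, `z` still beats a glued block

For the pair `(x, z)` the avoidance events `{z ↮ v}` are closed under (shrinking `C_x`, enlarging `C_z`)-complements, so
own-edge stability plus the lonely-cluster transfer give `μ(E ∩ R_x) ≤ μ(E ∩ R_z)` on any event
`E = {z ↮ x} ∩ ⋂_{v ∈ S} {z ↮ v}`; and gluing a SECOND star at a vertex `y` avoided by `z` transports this inequality, because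
on `{z ↮ y, z ↮ t}` opening `s(y,t)` does not change the cluster of `z` while it can only enlarge the cluster of `x`.  This is the
step "μ^σ(z ∉ U, R_{W₁}) ≤ μ^σ(z ∉ U, R_z)" of the crux memo (HULLPORT-COUPLING.md §15), valid although `z` need NOT dominate `W₁`
in the two-block graph. -/

/-- Transfer on an avoidance event: if `μ(R_x) ≤ μ(R_z)` then for every finite `S`,
`μ(z ↮ x, z ↮ S, R_x) ≤ μ(z ↮ x, z ↮ S, R_z)`. [cite: VandenbergHaggstromKahn2005, Thm. 1.5 (p. 7) — corollary] -/
theorem transfer_on_avoid (u : Sym2 (Fin n) → unitInterval) (A : Finset (Fin n)) (x z : Fin n) (j : ℕ) (hzx : z ≠ x)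
    (S : Finset (Fin n))
    (hdom : (prodBernoulli u).real {ω : BondConfig (Fin n) | (A.filter fun q => ω ∈ openConn x q).card ≤ j} ≤
      (prodBernoulli u).real {ω : BondConfig (Fin n) | (A.filter fun q => ω ∈ openConn z q).card ≤ j}) :
    (prodBernoulli u).real {ω : BondConfig (Fin n) | ¬ (openGraph ω).Reachable z x ∧
        (∀ v ∈ S, ¬ (openGraph ω).Reachable z v) ∧ (A.filter fun q => ω ∈ openConn x q).card ≤ j} ≤
      (prodBernoulli u).real {ω : BondConfig (Fin n) | ¬ (openGraph ω).Reachable z x ∧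
        (∀ v ∈ S, ¬ (openGraph ω).Reachable z v) ∧ (A.filter fun q => ω ∈ openConn z q).card ≤ j} := by
  set μ := prodBernoulli u with hμ
  have hmeas : ∀ W : Set (BondConfig (Fin n)), MeasurableSet W := fun W => (Set.toFinite W).measurableSet
  set Rx : Set (BondConfig (Fin n)) := {ω | (A.filter fun q => ω ∈ openConn x q).card ≤ j} with hRx
  set Rz : Set (BondConfig (Fin n)) := {ω | (A.filter fun q => ω ∈ openConn z q).card ≤ j} with hRz
  set D : Set (BondConfig (Fin n)) := (openConn x z)ᶜ with hD
  set B : Set (BondConfig (Fin n)) := {ω | ∃ v ∈ S, ω ∈ openConn z v} with hB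
  have hBt : ∀ ⦃ω ω' : BondConfig (Fin n)⦄, openEdgeCluster ω' x ⊆ openEdgeCluster ω x →
      openEdgeCluster ω z ⊆ openEdgeCluster ω' z → ω ∈ B → ω' ∈ B := by
    rintro ω ω' hs ht ⟨v, hv, hω⟩
    exact ⟨v, hv, typeMinus_openConn x z v hs ht hω⟩
  have hT := lonelyClusterTransfer_typeMinus u hzx.symm A j hBt hdom
  change μ.real (D ∩ (Rz ∩ B)) ≤ μ.real (D ∩ (B ∩ Rx)) + (μ.real Rz - μ.real Rx) at hT
  -- on `{x ↔ z}` the loneliness events coincide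
  have hDc : Rz \ D = Rx \ D := by
    ext ω
    simp only [hRz, hRx, hD, mem_sdiff, mem_compl_iff, not_not, mem_setOf_eq]
    constructor
    · rintro ⟨h, hxz⟩
      have h' : (openGraph ω).Reachable x z := hxz
      have heq : (A.filter fun q => ω ∈ openConn z q) = (A.filter fun q => ω ∈ openConn x q) :=
        Finset.filter_congr fun q _ =>
          ⟨fun hq => (h'.trans hq : (openGraph ω).Reachable x q), fun hq => (h'.symm.trans hq : (openGraph ω).Reachable z q)⟩
      rw [heq] at h; exact ⟨h, hxz⟩
    · rintro ⟨h, hxz⟩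
      have h' : (openGraph ω).Reachable x z := hxz
      have heq : (A.filter fun q => ω ∈ openConn x q) = (A.filter fun q => ω ∈ openConn z q) :=
        Finset.filter_congr fun q _ =>
          ⟨fun hq => (h'.symm.trans hq : (openGraph ω).Reachable z q), fun hq => (h'.trans hq : (openGraph ω).Reachable x q)⟩
      rw [heq] at h; exact ⟨h, hxz⟩
  have sz1 : μ.real (Rz ∩ D) + μ.real (Rz \ D) = μ.real Rz := measureReal_inter_add_sdiff (hmeas D)
  have sx1 : μ.real (Rx ∩ D) + μ.real (Rx \ D) = μ.real Rx := measureReal_inter_add_sdiff (hmeas D)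
  have sz2 : μ.real (Rz ∩ D ∩ B) + μ.real ((Rz ∩ D) \ B) = μ.real (Rz ∩ D) := measureReal_inter_add_sdiff (hmeas B)
  have sx2 : μ.real (Rx ∩ D ∩ B) + μ.real ((Rx ∩ D) \ B) = μ.real (Rx ∩ D) := measureReal_inter_add_sdiff (hmeas B)
  have e1 : Rz ∩ D ∩ B = D ∩ (Rz ∩ B) := by ext ω; simp only [mem_inter_iff]; tauto
  have e2 : Rx ∩ D ∩ B = D ∩ (B ∩ Rx) := by ext ω; simp only [mem_inter_iff]; tauto
  have tx : {ω : BondConfig (Fin n) | ¬ (openGraph ω).Reachable z x ∧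
        (∀ v ∈ S, ¬ (openGraph ω).Reachable z v) ∧ (A.filter fun q => ω ∈ openConn x q).card ≤ j} = (Rx ∩ D) \ B := by
    ext ω
    simp only [hRx, hD, hB, mem_sdiff, mem_inter_iff, mem_compl_iff, mem_setOf_eq, openConn, not_exists, not_and]
    constructor
    · rintro ⟨h1, h2, h3⟩; exact ⟨⟨h3, fun h => h1 h.symm⟩, h2⟩
    · rintro ⟨⟨h3, h1⟩, h2⟩; exact ⟨fun h => h1 h.symm, h2, h3⟩
  have tz : {ω : BondConfig (Fin n) | ¬ (openGraph ω).Reachable z x ∧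
        (∀ v ∈ S, ¬ (openGraph ω).Reachable z v) ∧ (A.filter fun q => ω ∈ openConn z q).card ≤ j} = (Rz ∩ D) \ B := by
    ext ω
    simp only [hRz, hD, hB, mem_sdiff, mem_inter_iff, mem_compl_iff, mem_setOf_eq, openConn, not_exists, not_and]
    constructor
    · rintro ⟨h1, h2, h3⟩; exact ⟨⟨h3, fun h => h1 h.symm⟩, h2⟩
    · rintro ⟨⟨h3, h1⟩, h2⟩; exact ⟨fun h => h1 h.symm, h2, h3⟩
  rw [tx, tz]
  rw [e1] at sz2; rw [e2] at sx2; rw [hDc] at sz1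
  linarith

/-- **Localized transfer through a second glued star.**  Let `μ_u(R_x) ≤ μ_u(R_z)`, `z ≠ x`, and let `y` be a vertex
with `u s(y,t) = 0` for `t ∈ T` (`y ∉ T`, `z ∉ T`).  Glue `y` to `T`: `u_T = u[s(y,t) ↦ 1, t ∈ T]`.  Then for every finite `S`,
`μ_{u_T}(z ↮ x, z ↮ y, z ↮ S, R_x) ≤ μ_{u_T}(z ↮ x, z ↮ y, z ↮ S, R_z)` — although `z` need not dominate `x` under `u_T`.
[cite: VandenbergHaggstromKahn2005, Thm. 1.5 (p. 7) — via `transfer_on_avoid`] -/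
theorem localizedTransfer_gluedStar (u : Sym2 (Fin n) → unitInterval) (A : Finset (Fin n)) (x y z : Fin n) (j : ℕ)
    (hzx : z ≠ x) (T : Finset (Fin n)) (hyT : y ∉ T) (hzT : z ∉ T)
    (hu : ∀ t ∈ T, u s(y, t) = 0)
    (hdom : (prodBernoulli u).real {ω : BondConfig (Fin n) | (A.filter fun q => ω ∈ openConn x q).card ≤ j} ≤
      (prodBernoulli u).real {ω : BondConfig (Fin n) | (A.filter fun q => ω ∈ openConn z q).card ≤ j})
    (S : Finset (Fin n)) :
    (prodBernoulli (fun e => if ∃ t ∈ T, e = s(y, t) then 1 else u e)).real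
        {ω : BondConfig (Fin n) | ¬ (openGraph ω).Reachable z x ∧ ¬ (openGraph ω).Reachable z y ∧
          (∀ v ∈ S, ¬ (openGraph ω).Reachable z v) ∧ (A.filter fun q => ω ∈ openConn x q).card ≤ j} ≤
      (prodBernoulli (fun e => if ∃ t ∈ T, e = s(y, t) then 1 else u e)).real
        {ω : BondConfig (Fin n) | ¬ (openGraph ω).Reachable z x ∧ ¬ (openGraph ω).Reachable z y ∧
          (∀ v ∈ S, ¬ (openGraph ω).Reachable z v) ∧ (A.filter fun q => ω ∈ openConn z q).card ≤ j} := by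
  induction T using Finset.induction_on generalizing S with
  | empty =>
    have hu0 : (fun e => if ∃ t ∈ (∅ : Finset (Fin n)), e = s(y, t) then (1 : unitInterval) else u e) = u := by
      funext e; simp only [Finset.notMem_empty, false_and, exists_false, if_false]
    rw [hu0]
    have key := transfer_on_avoid u A x z j hzx (insert y S) hdom
    have e1 : ∀ (R : BondConfig (Fin n) → Prop),
        {ω : BondConfig (Fin n) | ¬ (openGraph ω).Reachable z x ∧ ¬ (openGraph ω).Reachable z y ∧
          (∀ v ∈ S, ¬ (openGraph ω).Reachable z v) ∧ R ω} =
        {ω : BondConfig (Fin n) | ¬ (openGraph ω).Reachable z x ∧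
          (∀ v ∈ insert y S, ¬ (openGraph ω).Reachable z v) ∧ R ω} := by
      intro R; ext ω
      simp only [mem_setOf_eq, Finset.forall_mem_insert]
      tauto
    rw [e1, e1]; exact key
  | @insert t T htT ih =>
    set uT : Sym2 (Fin n) → unitInterval := fun e => if ∃ t' ∈ T, e = s(y, t') then 1 else u e with huT
    have hupd : (fun e => if ∃ t' ∈ insert t T, e = s(y, t') then (1 : unitInterval) else u e) =
        Function.update uT s(y, t) 1 := by
      funext e
      by_cases he : e = s(y, t)
      · subst he
        rw [Function.update_self]
        simp only [Finset.mem_insert, exists_eq_or_imp, true_or, if_true]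
      · rw [Function.update_of_ne he]
        simp only [huT, Finset.mem_insert, exists_eq_or_imp, he, false_or]
    rw [hupd]
    have hyt : y ≠ t := fun h => hyT (h ▸ Finset.mem_insert_self t T)
    have hzt : z ≠ t := fun h => hzT (h ▸ Finset.mem_insert_self t T)
    have huTt : uT s(y, t) = 0 := by
      have hne : ¬ ∃ t' ∈ T, s(y, t) = s(y, t') := by
        rintro ⟨t', ht', h⟩
        have : t = t' := by
          rcases Sym2.eq_iff.1 h with ⟨_, h⟩ | ⟨_, h⟩
          · exact h
          · exact absurd h.symm hyt
        exact htT (this ▸ ht')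
      simp only [huT, hne, if_false]
      exact hu t (Finset.mem_insert_self t T)
    have ih' := ih (fun h => hyT (Finset.mem_insert_of_mem h)) (fun h => hzT (Finset.mem_insert_of_mem h))
      (fun t' ht' => hu t' (Finset.mem_insert_of_mem ht')) (insert t S)
    rw [real_update_one_eq uT huTt, real_update_one_eq uT huTt]
    -- preimages under opening `s(y,t)`
    have hpre : ∀ ω : BondConfig (Fin n),
        ¬ (openGraph (insert s(y, t) ω)).Reachable z x → ¬ (openGraph (insert s(y, t) ω)).Reachable z y →
          ¬ (openGraph ω).Reachable z y ∧ ¬ (openGraph ω).Reachable z t := by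
      intro ω _ hzy'
      have hy' : ¬ (openGraph ω).Reachable z y := fun h =>
        hzy' ((reachable_insert_iff ω hyt z y).2 (Or.inl h))
      refine ⟨hy', fun h => hzy' ?_⟩
      exact (reachable_insert_iff ω hyt z y).2
        (Or.inr ⟨⟨t, by simp, h⟩, ⟨y, by simp, SimpleGraph.Reachable.refl y⟩⟩)
    have hsame : ∀ ω : BondConfig (Fin n), ¬ (openGraph ω).Reachable z y → ¬ (openGraph ω).Reachable z t →
        ∀ q, (openGraph (insert s(y, t) ω)).Reachable z q ↔ (openGraph ω).Reachable z q :=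
      fun ω h1 h2 q => reachable_insert_iff_of_not ω hyt h1 h2 q
    -- the `R_x` side: the preimage lies in the avoidance event with `t` added
    have subx : (fun ω : BondConfig (Fin n) => insert s(y, t) ω) ⁻¹'
        {ω : BondConfig (Fin n) | ¬ (openGraph ω).Reachable z x ∧ ¬ (openGraph ω).Reachable z y ∧
          (∀ v ∈ S, ¬ (openGraph ω).Reachable z v) ∧ (A.filter fun q => ω ∈ openConn x q).card ≤ j} ⊆
        {ω : BondConfig (Fin n) | ¬ (openGraph ω).Reachable z x ∧ ¬ (openGraph ω).Reachable z y ∧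
          (∀ v ∈ insert t S, ¬ (openGraph ω).Reachable z v) ∧ (A.filter fun q => ω ∈ openConn x q).card ≤ j} := by
      intro ω hω
      simp only [mem_preimage, mem_setOf_eq] at hω
      obtain ⟨hzx', hzy', hS', hR⟩ := hω
      obtain ⟨hy', ht'⟩ := hpre ω hzx' hzy'
      have hs := hsame ω hy' ht'
      refine ⟨fun h => hzx' ((hs x).2 h), hy', ?_, le_trans (Finset.card_le_card ?_) hR⟩
      · intro v hv
        rcases Finset.mem_insert.1 hv with rfl | hv
        · exact ht'
        · exact fun h => hS' v hv ((hs v).2 h)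
      · intro q hq
        rw [Finset.mem_filter] at hq ⊢
        refine ⟨hq.1, ?_⟩
        have h' : (openGraph ω).Reachable x q := hq.2
        exact ((reachable_insert_iff ω hyt x q).2 (Or.inl h') : (openGraph (insert s(y, t) ω)).Reachable x q)
    -- the `R_z` side: the preimage IS the avoidance event with `t` added
    have eqz : (fun ω : BondConfig (Fin n) => insert s(y, t) ω) ⁻¹'
        {ω : BondConfig (Fin n) | ¬ (openGraph ω).Reachable z x ∧ ¬ (openGraph ω).Reachable z y ∧
          (∀ v ∈ S, ¬ (openGraph ω).Reachable z v) ∧ (A.filter fun q => ω ∈ openConn z q).card ≤ j} =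
        {ω : BondConfig (Fin n) | ¬ (openGraph ω).Reachable z x ∧ ¬ (openGraph ω).Reachable z y ∧
          (∀ v ∈ insert t S, ¬ (openGraph ω).Reachable z v) ∧ (A.filter fun q => ω ∈ openConn z q).card ≤ j} := by
      ext ω
      simp only [mem_preimage, mem_setOf_eq]
      constructor
      · rintro ⟨hzx', hzy', hS', hR⟩
        obtain ⟨hy', ht'⟩ := hpre ω hzx' hzy'
        have hs := hsame ω hy' ht'
        refine ⟨fun h => hzx' ((hs x).2 h), hy', ?_, ?_⟩
        · intro v hv
          rcases Finset.mem_insert.1 hv with rfl | hv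
          · exact ht'
          · exact fun h => hS' v hv ((hs v).2 h)
        · have heq : (A.filter fun q => insert s(y, t) ω ∈ openConn z q) = (A.filter fun q => ω ∈ openConn z q) :=
            Finset.filter_congr fun q _ => hs q
          rw [heq] at hR; exact hR
      · rintro ⟨hzx', hzy', hS', hR⟩
        have ht' : ¬ (openGraph ω).Reachable z t := hS' t (Finset.mem_insert_self t S)
        have hs := hsame ω hzy' ht'
        refine ⟨fun h => hzx' ((hs x).1 h), fun h => hzy' ((hs y).1 h), fun v hv h => hS' v (Finset.mem_insert_of_mem hv) ((hs v).1 h), ?_⟩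
        have heq : (A.filter fun q => insert s(y, t) ω ∈ openConn z q) = (A.filter fun q => ω ∈ openConn z q) :=
          Finset.filter_congr fun q _ => hs q
        rw [heq]; exact hR
    rw [eqz]
    exact (measureReal_mono subx (measure_ne_top _ _)).trans ih'

/-- **(T⁻)_σ modulo the localized selection lemma.**  Let `K` have `K s(x_i,t) = 0` for `t ∈ T_i` (`i = 1,2`), let `z`
dominate every `t ∈ T₁ ∪ T₂` in `K`-loneliness, and let `u = K[s(x_i,t) ↦ 1]` be the two-block scenario graph.  If an event `Ψ`
satisfies the LOCALIZED SELECTION BOUND `μ_u(z ∉ U, Ψ) ≤ max_i μ_u(z ∉ U, R_{x_i})` (crux memo §15–§16; for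
`Ψ = [b ∈ U ∧ R_b] ∨ [b ∉ U ∧ |π(U)| ≤ j]` this is the open lemma LSL, 0 / 6 799 numerically), then
`μ_u(z ∉ U, Ψ) ≤ μ_u(z ∉ U, R_z)`: `dominates_gluedStar` for each block and `localizedTransfer_gluedStar` through the other.
[cite: VandenbergHaggstromKahn2005, Thm. 1.5 (p. 7) — via the lemmas above] -/
theorem threeCluster_scenario_of_LSL (K : Sym2 (Fin n) → unitInterval) (A : Finset (Fin n)) (x₁ x₂ z : Fin n) (j : ℕ)
    (hx : x₁ ≠ x₂) (hz₁ : z ≠ x₁) (hz₂ : z ≠ x₂) (T₁ T₂ : Finset (Fin n))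
    (h₁ : x₁ ∉ T₁) (h₂ : x₂ ∉ T₂) (h₂₁ : x₂ ∉ T₁) (hzT₁ : z ∉ T₁) (hzT₂ : z ∉ T₂)
    (hT₁ : T₁.Nonempty) (hT₂ : T₂.Nonempty)
    (hK₁ : ∀ t ∈ T₁, K s(x₁, t) = 0) (hK₂ : ∀ t ∈ T₂, K s(x₂, t) = 0)
    (hdom : ∀ t ∈ T₁ ∪ T₂,
      (prodBernoulli K).real {ω : BondConfig (Fin n) | (A.filter fun q => ω ∈ openConn t q).card ≤ j} ≤
        (prodBernoulli K).real {ω : BondConfig (Fin n) | (A.filter fun q => ω ∈ openConn z q).card ≤ j})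
    (Ψ : Set (BondConfig (Fin n)))
    (hLSL : (prodBernoulli (fun e => if ∃ t ∈ T₂, e = s(x₂, t) then 1 else if ∃ t ∈ T₁, e = s(x₁, t) then 1 else K e)).real
        ({ω : BondConfig (Fin n) | ¬ (openGraph ω).Reachable z x₁ ∧ ¬ (openGraph ω).Reachable z x₂} ∩ Ψ) ≤
      max ((prodBernoulli (fun e => if ∃ t ∈ T₂, e = s(x₂, t) then 1 else if ∃ t ∈ T₁, e = s(x₁, t) then 1 else K e)).real
            {ω : BondConfig (Fin n) | ¬ (openGraph ω).Reachable z x₁ ∧ ¬ (openGraph ω).Reachable z x₂ ∧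
              (A.filter fun q => ω ∈ openConn x₁ q).card ≤ j})
          ((prodBernoulli (fun e => if ∃ t ∈ T₂, e = s(x₂, t) then 1 else if ∃ t ∈ T₁, e = s(x₁, t) then 1 else K e)).real
            {ω : BondConfig (Fin n) | ¬ (openGraph ω).Reachable z x₁ ∧ ¬ (openGraph ω).Reachable z x₂ ∧
              (A.filter fun q => ω ∈ openConn x₂ q).card ≤ j})) :
    (prodBernoulli (fun e => if ∃ t ∈ T₂, e = s(x₂, t) then 1 else if ∃ t ∈ T₁, e = s(x₁, t) then 1 else K e)).real
        ({ω : BondConfig (Fin n) | ¬ (openGraph ω).Reachable z x₁ ∧ ¬ (openGraph ω).Reachable z x₂} ∩ Ψ) ≤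
      (prodBernoulli (fun e => if ∃ t ∈ T₂, e = s(x₂, t) then 1 else if ∃ t ∈ T₁, e = s(x₁, t) then 1 else K e)).real
        {ω : BondConfig (Fin n) | ¬ (openGraph ω).Reachable z x₁ ∧ ¬ (openGraph ω).Reachable z x₂ ∧
          (A.filter fun q => ω ∈ openConn z q).card ≤ j} := by
  set u₁ : Sym2 (Fin n) → unitInterval := fun e => if ∃ t ∈ T₁, e = s(x₁, t) then 1 else K e with hu₁
  set u₂ : Sym2 (Fin n) → unitInterval := fun e => if ∃ t ∈ T₂, e = s(x₂, t) then 1 else K e with hu₂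
  set u : Sym2 (Fin n) → unitInterval := fun e => if ∃ t ∈ T₂, e = s(x₂, t) then 1 else u₁ e with hu
  -- no pair is a coin of both observers
  have hne : ∀ t t' : Fin n, t ∈ T₂ → t' ∈ T₁ → s(x₂, t) ≠ s(x₁, t') := by
    intro t t' ht ht' h
    rcases Sym2.eq_iff.1 h with ⟨h1, _⟩ | ⟨h1, _⟩
    · exact hx h1.symm
    · exact h₂₁ (h1 ▸ ht')
  have hu₁₂ : ∀ t ∈ T₂, u₁ s(x₂, t) = 0 := by
    intro t ht
    have : ¬ ∃ t' ∈ T₁, s(x₂, t) = s(x₁, t') := by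
      rintro ⟨t', ht', h⟩; exact hne t t' ht ht' h
    simp only [hu₁, this, if_false]; exact hK₂ t ht
  have hu₂₁ : ∀ t ∈ T₁, u₂ s(x₁, t) = 0 := by
    intro t ht
    have : ¬ ∃ t' ∈ T₂, s(x₁, t) = s(x₂, t') := by
      rintro ⟨t', ht', h⟩; exact hne t' t ht' ht h.symm
    simp only [hu₂, this, if_false]; exact hK₁ t ht
  -- the other gluing order gives the same weights
  have hu' : (fun e => if ∃ t ∈ T₁, e = s(x₁, t) then (1 : unitInterval) else u₂ e) = u := by
    funext e
    by_cases hA : ∃ t ∈ T₁, e = s(x₁, t)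
    · obtain ⟨t, ht, rfl⟩ := hA
      have hB : ¬ ∃ t' ∈ T₂, s(x₁, t) = s(x₂, t') := by
        rintro ⟨t', ht', h⟩; exact hne t' t ht' ht h.symm
      simp only [hu, hu₁, hB, if_false]
      rw [if_pos ⟨t, ht, rfl⟩, if_pos ⟨t, ht, rfl⟩]
    · simp only [hu, hu₁, hu₂, hA, if_false]
  -- block 1
  have d₁ := dominates_gluedStar K A x₁ z j hz₁ T₁ h₁ hT₁ hK₁ (fun t ht => hdom t (Finset.mem_union_left _ ht))
  have l₁ := localizedTransfer_gluedStar u₁ A x₁ x₂ z j hz₁ T₂ h₂ hzT₂ hu₁₂ d₁ ∅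
  -- block 2
  have d₂ := dominates_gluedStar K A x₂ z j hz₂ T₂ h₂ hT₂ hK₂ (fun t ht => hdom t (Finset.mem_union_right _ ht))
  have l₂ := localizedTransfer_gluedStar u₂ A x₂ x₁ z j hz₂ T₁ h₁ hzT₁ hu₂₁ d₂ ∅
  rw [hu'] at l₂
  -- remove the empty avoidance set and align conjunct orders
  have e1 : ∀ (P : BondConfig (Fin n) → Prop),
      {ω : BondConfig (Fin n) | ¬ (openGraph ω).Reachable z x₁ ∧ ¬ (openGraph ω).Reachable z x₂ ∧
        (∀ v ∈ (∅ : Finset (Fin n)), ¬ (openGraph ω).Reachable z v) ∧ P ω} =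
      {ω : BondConfig (Fin n) | ¬ (openGraph ω).Reachable z x₁ ∧ ¬ (openGraph ω).Reachable z x₂ ∧ P ω} := by
    intro P; ext ω; simp only [mem_setOf_eq, Finset.notMem_empty, false_imp_iff, imp_true_iff, true_and]
  have e2 : ∀ (P : BondConfig (Fin n) → Prop),
      {ω : BondConfig (Fin n) | ¬ (openGraph ω).Reachable z x₂ ∧ ¬ (openGraph ω).Reachable z x₁ ∧
        (∀ v ∈ (∅ : Finset (Fin n)), ¬ (openGraph ω).Reachable z v) ∧ P ω} =
      {ω : BondConfig (Fin n) | ¬ (openGraph ω).Reachable z x₁ ∧ ¬ (openGraph ω).Reachable z x₂ ∧ P ω} := by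
    intro P; ext ω
    simp only [mem_setOf_eq, Finset.notMem_empty, false_imp_iff, imp_true_iff, true_and]
    tauto
  rw [e1, e1] at l₁
  rw [e2, e2] at l₂
  exact hLSL.trans (max_le l₁ l₂)

end HullPort

end Summit.CriticalPhenomena.PercolationContinuityZ3.Theorems

end
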